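import Literature.NumberTheory.Sieve.BombieriAsymptoticSievePrDistributionMin
import Literature.NumberTheory.Sieve.BombieriAsymptoticSievePrDistributionProofs
import HarnessLib

/-!
# Bombieri's asymptotic sieve: the rough `P_r`-cells of a Bombieri sequence

Topic `Literature/NumberTheory/Sieve`, family `parity`. Proof file (no named fact is introduced)
drawing the SHARP-CUTOFF consequence of the named fact `Bombieri1976_PrDistributionMin`
(`BombieriAsymptoticSievePrDistributionMin.lean`: [BombieriRIMS1977] p. 5 Theorem, every `r ≥ 2`,
test functions of the smallest prime factor):

* `BombieriRoughCells.roughCell_isLittleO` — if `A` satisfies Bombieri's (A₁)–(A₅) with density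
  constant `H`, then for every `r ≥ 2` and every depth `U > 1` the rough cell
  `C_r(x, U) = ∑_{n ≤ x, n squarefree, ω(n) = r, p_min(n) ≥ x^{1/U}} a_n` satisfies
  `C_r(x, U) = I_r(U)·M_r(x) + o(A(x)/log x)`, `M_r(x) = (1 + (−1)^r) H A(x)/log x − (−1)^r ∑_{p ≤ x} a_p`,
  with Buchstab–Alladi's cell density `I_r(U) = roughCellDensity r U`; i.e. every ODD cell is
  `I_r(U) ∑_{p ≤ x} a_p + o(A/log x)` (the parity ghost `δ_x` of the primes propagates to all odd
  cells, "once `δ_x` is known everything is known", [BombieriRIMS1977] p. 5) and every EVEN cell is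
  `I_r(U) (2 H A/log x − ∑_p a_p) + o(A/log x)`;
* `BombieriRoughCells.roughCell_isLittleO'` — the same, division-free display.

Ingredients (all proved here): the kernel `K_r(w) = I_{r−1}(w−1)/(w−1)` of `bombieriMinWeight`
(`0 ≤ K_r ≤ 1`, measurable, `∫_1^V K_r = I_r(V)` by Buchstab's iteration
`roughCellDensity_succ_succ_eq_integral_sub`), the reduction of the weight of a test function
supported in `[η, ∞)` to a finite interval and its comparison with sharp cutoffs
(`weight_le_roughCellDensity`, `roughCellDensity_le_weight`), continuous ramps, the two sandwich
inequalities for the sharp cutoff `p_min(n) ≥ x^{1/U}` against ramps of `u₁ = log p_min/log n`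
(`roughCell_le_prSum`; `prSum_le_roughCell_add`, whose tail `n ≤ x^{1−θ'}` is controlled by the law
at `x^{1−θ'}` and `A(x^{1−θ'}) = o(A(x))`, `BombieriP2.size_rpow_isLittleO`), the Chebyshev bound
`BombieriP2.chebyshev_primeCount`, and the continuity of `I_r` at `U`.

Consumer: the `Parity/BatemanHorn` crux `OddSectorShareLinear` (stmt-Parity-15629): for `k = 2`
its one-background form ("mixed share anatomy", tree
`Summit.Parity.BatemanHorn.Cruxes.OddSectorShareLinear.Birth.OddSectorShareLinear_of_mixedShareAnatomy`)
asks exactly that the odd rough cells of the sequence `(f_m(n))_{n ∈ background}` be in Alladi's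
proportions `I_r(U)`, which is what `roughCell_isLittleO` gives for a Bombieri sequence whose prime
density `δ_x` is bounded below.
-/


noncomputable section

open Filter Asymptotics Finset MeasureTheory Set intervalIntegral
open scoped Topology ArithmeticFunction.omega

namespace Literature.NumberTheory.Sieve

namespace BombieriRoughCells

/-! ### The kernel `K_r(w) = I_{r−1}(w − 1)/(w − 1)` of `bombieriMinWeight` -/

/-- The kernel of `bombieriMinWeight r`: `K_r(w) = I_{r−1}(w − 1)/(w − 1)`. [folklore] -/
def kernel (r : ℕ) (w : ℝ) : ℝ := roughCellDensity (r - 1) (w - 1) / (w - 1)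

/-- `K_r(w) = 0` for `w < 2` when `r ≥ 2` (`I_{r−1}(w − 1) = 0` for `w − 1 < 1 ≤ r − 1`). [folklore] -/
theorem kernel_eq_zero_of_lt_two {r : ℕ} (hr : 2 ≤ r) {w : ℝ} (hw : w < 2) : kernel r w = 0 := by
  unfold kernel
  have h1 : 1 ≤ r - 1 := by omega
  have : w - 1 < ((r - 1 : ℕ) : ℝ) := by
    have : (1 : ℝ) ≤ ((r - 1 : ℕ) : ℝ) := by exact_mod_cast h1
    linarith
  rw [roughCellDensity_of_lt (r - 1) this, zero_div]

/-- `0 ≤ K_r(w)` for every `w` (`r ≥ 2`). [folklore] -/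
theorem kernel_nonneg {r : ℕ} (hr : 2 ≤ r) (w : ℝ) : 0 ≤ kernel r w := by
  rcases lt_or_ge w 2 with hw | hw
  · rw [kernel_eq_zero_of_lt_two hr hw]
  · exact div_nonneg (roughCellDensity_nonneg _ _) (by linarith)

/-- `K_r(w) ≤ 1` for every `w` (`r ≥ 2`; `I_j(t) ≤ t` for `t ≥ 1`). [folklore] -/
theorem kernel_le_one {r : ℕ} (hr : 2 ≤ r) (w : ℝ) : kernel r w ≤ 1 := by
  rcases lt_or_ge w 2 with hw | hw
  · rw [kernel_eq_zero_of_lt_two hr hw]; exact zero_le_one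
  · unfold kernel
    have h1 : 1 ≤ r - 1 := by omega
    have hw1 : (1 : ℝ) ≤ w - 1 := by linarith
    rw [div_le_one (by linarith)]
    exact roughCellDensity_le h1 hw1

/-- `I_j` is measurable for every `j`. [folklore] -/
theorem measurable_roughCellDensity (j : ℕ) : Measurable (roughCellDensity j) := by
  rcases Nat.lt_or_ge j 2 with hj | hj
  · interval_cases j
    · exact measurable_const
    · have : roughCellDensity 1 = fun u : ℝ => if 1 ≤ u then (1 : ℝ) else 0 := by
        funext u; exact roughCellDensity_one u
      rw [this]
      exact Measurable.ite measurableSet_Ici measurable_const measurable_const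
  · exact (continuous_roughCellDensity hj).measurable

/-- The kernel is measurable. [folklore] -/
theorem measurable_kernel (r : ℕ) : Measurable (kernel r) :=
  ((measurable_roughCellDensity (r - 1)).comp (measurable_id.sub_const 1)).div
    (measurable_id.sub_const 1)

/-- The kernel is continuous on `[2, ∞)` for `r ≥ 2` (`t ↦ I_{r−1}(t)/t` is continuous on `[1, ∞)`). [folklore] -/
theorem continuousOn_kernel {r : ℕ} (hr : 2 ≤ r) : ContinuousOn (kernel r) (Ici 2) := by
  have h1 : 1 ≤ r - 1 := by omega
  have h := continuousOn_roughCellDensity_div h1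
  refine (h.comp (continuousOn_id.sub continuousOn_const) fun w hw => ?_)
  simp only [Set.mem_Ici] at hw ⊢
  linarith

/-- The kernel is interval integrable on every `[a, b]`. [folklore] -/
theorem intervalIntegrable_kernel {r : ℕ} (hr : 2 ≤ r) (a b : ℝ) :
    IntervalIntegrable (kernel r) volume a b := by
  refine (intervalIntegrable_const (c := (1 : ℝ))).mono_fun'
    (measurable_kernel r).aestronglyMeasurable ?_
  refine Eventually.of_forall fun w => ?_
  show ‖kernel r w‖ ≤ 1
  rw [Real.norm_eq_abs, abs_of_nonneg (kernel_nonneg hr w)]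
  exact kernel_le_one hr w

/-- `∫_1^V K_r(w) dw = I_r(V)` for `r ≥ 2` (Buchstab's iteration
`I_{j+2}(u) = ∫_2^u I_{j+1}(v − 1) dv/(v − 1)`, and `K_r = 0` on `(1, 2)`). [folklore] -/
theorem integral_kernel_eq {r : ℕ} (hr : 2 ≤ r) (V : ℝ) :
    ∫ w in (1 : ℝ)..V, kernel r w = roughCellDensity r V := by
  obtain ⟨j, rfl⟩ : ∃ j, r = j + 2 := ⟨r - 2, by omega⟩
  have hzero : ∫ w in (1 : ℝ)..(min V 2), kernel (j + 2) w = 0 := by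
    refine intervalIntegral_eq_zero_of_forall_mem_Ioo fun t ht => ?_
    refine kernel_eq_zero_of_lt_two hr (lt_of_lt_of_le ht.2 ?_)
    exact max_le (by linarith [min_le_right V 2]) (min_le_right V 2)
  rcases le_or_gt V 2 with hV2 | hV2
  · rw [min_eq_left hV2] at hzero
    rw [hzero, roughCellDensity_of_le (by omega) (by push_cast; linarith)]
  · rw [min_eq_right hV2.le] at hzero
    rw [← integral_add_adjacent_intervals (intervalIntegrable_kernel hr 1 2)
      (intervalIntegrable_kernel hr 2 V), hzero, zero_add, roughCellDensity_succ_succ_eq_integral_sub]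
    rfl

/-! ### The weight of a test function supported in `[η, ∞)`: reduction to a finite interval -/

/-- A continuous `g` is bounded on `[η, 1]`; hence `w ↦ g(1/w)` is bounded on `[1, ∞)` when `g`
vanishes on `(−∞, η]`. [folklore] -/
theorem exists_bound_comp_inv {g : ℝ → ℝ} (hg : Continuous g) {η : ℝ}
    (hgη : ∀ u, u ≤ η → g u = 0) : ∃ B : ℝ, 0 ≤ B ∧ ∀ w : ℝ, 1 ≤ w → |g (1 / w)| ≤ B := by
  obtain ⟨B, hB⟩ := isCompact_Icc.exists_bound_of_continuousOn (s := Icc η 1) hg.continuousOn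
  refine ⟨max B 0, le_max_right _ _, fun w hw => ?_⟩
  rcases le_or_gt (1 / w) η with h | h
  · rw [hgη _ h, abs_zero]; exact le_max_right _ _
  · have hw0 : 0 < w := by linarith
    have h1 : 1 / w ≤ 1 := by rw [div_le_one hw0]; exact hw
    exact (hB (1 / w) ⟨h.le, h1⟩).trans (le_max_left _ _)

/-- The integrand `w ↦ g(1/w) K_r(w)` is interval integrable on every `[a, b]` with `1 ≤ a, b`
(bounded and measurable there). [folklore] -/
theorem intervalIntegrable_integrand {r : ℕ} (hr : 2 ≤ r) {g : ℝ → ℝ} (hg : Continuous g) {η : ℝ}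
    (hgη : ∀ u, u ≤ η → g u = 0) {a b : ℝ} (ha : 1 ≤ a) (hb : 1 ≤ b) :
    IntervalIntegrable (fun w => g (1 / w) * kernel r w) volume a b := by
  obtain ⟨B, hB0, hB⟩ := exists_bound_comp_inv hg hgη
  have hmeas : Measurable fun w : ℝ => g (1 / w) * kernel r w :=
    (hg.measurable.comp (measurable_const.div measurable_id)).mul (measurable_kernel r)
  refine (intervalIntegrable_const (c := B)).mono_fun' hmeas.aestronglyMeasurable ?_
  rw [EventuallyLE, ae_restrict_iff' measurableSet_uIoc]
  refine Eventually.of_forall fun w hw => ?_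
  have hw1 : 1 ≤ w := by
    rw [mem_uIoc] at hw
    rcases hw with hw | hw
    · exact ha.trans hw.1.le
    · exact hb.trans hw.1.le
  rw [Real.norm_eq_abs, abs_mul, abs_of_nonneg (kernel_nonneg hr w)]
  calc |g (1 / w)| * kernel r w ≤ B * 1 :=
        mul_le_mul (hB w hw1) (kernel_le_one hr w) (kernel_nonneg hr w) hB0
    _ = B := mul_one B

/-- **Reduction to a finite interval**: if `g = 0` on `(−∞, η]` (`η > 0`) and `M ≥ max(1, 1/η)`, then
`bombieriMinWeight r g = ∫_1^M g(1/w) K_r(w) dw`. [folklore] -/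
theorem weight_eq_intervalIntegral {r : ℕ} {g : ℝ → ℝ} {η : ℝ} (hη : 0 < η)
    (hgη : ∀ u, u ≤ η → g u = 0) {M : ℝ} (hM1 : 1 ≤ M) (hMη : 1 / η ≤ M) :
    bombieriMinWeight r g = ∫ w in (1 : ℝ)..M, g (1 / w) * kernel r w := by
  unfold bombieriMinWeight
  have hEq : EqOn (fun w : ℝ => g (1 / w) * (roughCellDensity (r - 1) (w - 1) / (w - 1)))
      ((Iic M).indicator fun w : ℝ => g (1 / w) * kernel r w) (Ioi 1) := by
    intro w hw
    by_cases hwM : w ≤ M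
    · rw [indicator_of_mem (Set.mem_Iic.mpr hwM)]; rfl
    · rw [indicator_of_notMem (fun h => hwM (Set.mem_Iic.mp h))]
      have hw0 : 0 < w := lt_trans one_pos hw
      have h1 : 1 / w ≤ η := by
        rw [div_le_iff₀ hw0]
        have : 1 / η < w := lt_of_le_of_lt hMη (not_le.mp hwM)
        rw [div_lt_iff₀ hη] at this
        linarith
      show g (1 / w) * _ = 0
      rw [hgη _ h1, zero_mul]
  rw [setIntegral_congr_fun measurableSet_Ioi hEq, setIntegral_indicator measurableSet_Iic,
    show Ioi (1 : ℝ) ∩ Iic M = Ioc 1 M from rfl, integral_of_le hM1]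

/-- The weight of a nonnegative test function is nonnegative. [folklore] -/
theorem weight_nonneg {r : ℕ} (hr : 2 ≤ r) {g : ℝ → ℝ} {η : ℝ} (hη : 0 < η)
    (hgη : ∀ u, u ≤ η → g u = 0) (hg0 : ∀ u, 0 ≤ g u) : 0 ≤ bombieriMinWeight r g := by
  have hM1 : 1 ≤ max 1 (1 / η) := le_max_left _ _
  rw [weight_eq_intervalIntegral hη hgη hM1 (le_max_right _ _)]
  exact integral_nonneg hM1 fun w _ => mul_nonneg (hg0 _) (kernel_nonneg hr w)

/-- **Upper comparison with a sharp cutoff**: if `g ≤ 1` and `g(u) = 0` for `u ≤ 1/V` (`V ≥ 1`),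
then `bombieriMinWeight r g ≤ I_r(V)`. [folklore] -/
theorem weight_le_roughCellDensity {r : ℕ} (hr : 2 ≤ r) {g : ℝ → ℝ} (hg : Continuous g)
    (hg1 : ∀ u, g u ≤ 1) {V : ℝ} (hV : 1 ≤ V)
    (hgV : ∀ u, u ≤ 1 / V → g u = 0) : bombieriMinWeight r g ≤ roughCellDensity r V := by
  have hV0 : 0 < V := by linarith
  have hη : 0 < 1 / V := by positivity
  have hM : 1 / (1 / V) ≤ V := by rw [one_div_one_div]
  rw [weight_eq_intervalIntegral hη hgV hV hM, ← integral_kernel_eq hr V]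
  refine integral_mono_on hV (intervalIntegrable_integrand hr hg hgV le_rfl hV)
    (intervalIntegrable_kernel hr 1 V) fun w _ => ?_
  calc g (1 / w) * kernel r w ≤ 1 * kernel r w :=
        mul_le_mul_of_nonneg_right (hg1 _) (kernel_nonneg hr w)
    _ = kernel r w := one_mul _

/-- **Lower comparison with a sharp cutoff**: if `0 ≤ g`, `g` vanishes on `(−∞, η]` (`η > 0`) and
`g(u) = 1` for `u ≥ 1/V` (`V ≥ 1`), then `I_r(V) ≤ bombieriMinWeight r g`. [folklore] -/
theorem roughCellDensity_le_weight {r : ℕ} (hr : 2 ≤ r) {g : ℝ → ℝ} (hg : Continuous g)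
    (hg0 : ∀ u, 0 ≤ g u) {η : ℝ} (hη : 0 < η) (hgη : ∀ u, u ≤ η → g u = 0) {V : ℝ} (hV : 1 ≤ V)
    (hgV : ∀ u, 1 / V ≤ u → g u = 1) : roughCellDensity r V ≤ bombieriMinWeight r g := by
  have hV0 : 0 < V := by linarith
  -- `1/V > η` unless `g` is identically inconsistent; in fact `η < 1/V` since `g(1/V) = 1 ≠ 0`
  have hηV : η < 1 / V := by
    by_contra h
    have h1 := hgη (1 / V) (not_lt.mp h)
    have h2 := hgV (1 / V) le_rfl
    rw [h1] at h2
    exact zero_ne_one h2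
  set M : ℝ := max V (1 / η) with hM_def
  have hVM : V ≤ M := le_max_left _ _
  have hM1 : 1 ≤ M := hV.trans hVM
  rw [weight_eq_intervalIntegral hη hgη hM1 (le_max_right _ _), ← integral_kernel_eq hr V,
    ← integral_add_adjacent_intervals (intervalIntegrable_integrand hr hg hgη le_rfl hV)
      (intervalIntegrable_integrand hr hg hgη hV hM1)]
  have h2 : 0 ≤ ∫ w in V..M, g (1 / w) * kernel r w :=
    integral_nonneg hVM fun w _ => mul_nonneg (hg0 _) (kernel_nonneg hr w)
  have h1 : ∫ w in (1 : ℝ)..V, kernel r w ≤ ∫ w in (1 : ℝ)..V, g (1 / w) * kernel r w := by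
    refine integral_mono_on hV (intervalIntegrable_kernel hr 1 V)
      (intervalIntegrable_integrand hr hg hgη le_rfl hV) fun w hw => ?_
    rcases eq_or_lt_of_le hw.1 with h | h
    · -- `w = 1`: the kernel vanishes
      rw [← h, kernel_eq_zero_of_lt_two hr (by norm_num), mul_zero]
    · have hw0 : 0 < w := by linarith
      have : 1 / V ≤ 1 / w := one_div_le_one_div_of_le hw0 hw.2
      rw [hgV _ this, one_mul]
  linarith

/-! ### Ramp test functions -/

/-- The continuous ramp `ramp a θ u = min 1 (max 0 ((u − a)/θ))`: `0` on `(−∞, a]`, `1` on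
`[a + θ, ∞)`, values in `[0, 1]` (`θ > 0`). [folklore] -/
def ramp (a θ u : ℝ) : ℝ := min 1 (max 0 ((u - a) / θ))

/-- The ramp is continuous. [folklore] -/
theorem continuous_ramp (a θ : ℝ) : Continuous (ramp a θ) :=
  continuous_const.min (continuous_const.max ((continuous_id.sub continuous_const).div_const θ))

/-- The ramp is nonnegative. [folklore] -/
theorem ramp_nonneg (a θ u : ℝ) : 0 ≤ ramp a θ u := le_min zero_le_one (le_max_left _ _)

/-- The ramp is at most `1`. [folklore] -/
theorem ramp_le_one (a θ u : ℝ) : ramp a θ u ≤ 1 := min_le_left _ _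

/-- The ramp vanishes on `(−∞, a]`. [folklore] -/
theorem ramp_eq_zero {a θ u : ℝ} (hθ : 0 < θ) (hu : u ≤ a) : ramp a θ u = 0 := by
  unfold ramp
  have : (u - a) / θ ≤ 0 := div_nonpos_of_nonpos_of_nonneg (by linarith) hθ.le
  rw [max_eq_left this, min_eq_right zero_le_one]

/-- The ramp equals `1` on `[a + θ, ∞)`. [folklore] -/
theorem ramp_eq_one {a θ u : ℝ} (hθ : 0 < θ) (hu : a + θ ≤ u) : ramp a θ u = 1 := by
  unfold ramp
  have : 1 ≤ (u - a) / θ := by rw [le_div_iff₀ hθ]; linarith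
  rw [min_eq_left (le_max_of_le_right this)]


/-! ### The `P_r`-sums and the rough cells of a sieve sequence -/

/-- `S_r(g; x) = ∑_{n ≤ x, n squarefree, ω(n) = r} a_n g(log p_min(n)/log n)` — the `P_r`-sum of
`Bombieri1976_PrDistributionMin`. [folklore] -/
def prSum (A : SieveSequence) (r : ℕ) (g : ℝ → ℝ) (x : ℝ) : ℝ :=
  ∑ n ∈ (Finset.Icc 1 ⌊x⌋₊).filter (fun n : ℕ => Squarefree n ∧ ω n = r),
    A.a n * g (Real.log (Nat.minFac n) / Real.log n)

/-- The ROUGH `P_r`-CELL at depth `U`: `C_r(x, U) = ∑_{n ≤ x, n squarefree, ω(n) = r, p_min(n) ≥ x^{1/U}} a_n`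
(sharp cutoff at `x^{1/U}`, as in Buchstab–Alladi). [folklore] -/
def roughCell (A : SieveSequence) (r : ℕ) (U x : ℝ) : ℝ :=
  ∑ n ∈ ((Finset.Icc 1 ⌊x⌋₊).filter (fun n : ℕ => Squarefree n ∧ ω n = r)).filter
      (fun n : ℕ => x ^ (1 / U) ≤ (Nat.minFac n : ℝ)), A.a n

/-- Members of the `P_r`-filter are `≥ 2`, `≤ x`, with `2 ≤ p_min(n) ≤ n`. [folklore] -/
theorem two_le_of_mem {r : ℕ} (hr : 1 ≤ r) {x : ℝ} {n : ℕ}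
    (hn : n ∈ (Finset.Icc 1 ⌊x⌋₊).filter (fun n : ℕ => Squarefree n ∧ ω n = r)) : 2 ≤ n := by
  obtain ⟨hn1, hsq, hω⟩ := by simpa [Finset.mem_filter] using hn
  by_contra h
  have : n = 1 := by omega
  subst this
  simp [ArithmeticFunction.cardDistinctFactors_one] at hω
  omega

/-- **Upper sandwich**: if `g ≥ 0` and `g(u) = 1` for `u ≥ 1/U` (`U > 0`), then for `x ≥ 1`,
`C_r(x, U) ≤ S_r(g; x)` (a member of the cell has `u₁ = log p_min/log n ≥ log x^{1/U}/log x = 1/U`).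
[folklore] -/
theorem roughCell_le_prSum {A : SieveSequence} {r : ℕ} (hr : 1 ≤ r) {g : ℝ → ℝ} (hg0 : ∀ u, 0 ≤ g u)
    {U : ℝ} (hU : 0 < U) (hg1 : ∀ u, 1 / U ≤ u → g u = 1) {x : ℝ} (hx : 1 ≤ x) :
    roughCell A r U x ≤ prSum A r g x := by
  unfold roughCell prSum
  rw [Finset.sum_filter]
  refine Finset.sum_le_sum fun n hn => ?_
  split_ifs with hmf
  · have hn2 := two_le_of_mem hr hn
    have hnx : (n : ℝ) ≤ x := by
      have := (Finset.mem_Icc.mp (Finset.mem_filter.mp hn).1).2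
      exact (Nat.cast_le.mpr this).trans (Nat.floor_le (by linarith))
    have hn0 : (0 : ℝ) < n := by exact_mod_cast (by omega : 0 < n)
    have hlogn : 0 < Real.log n := Real.log_pos (by exact_mod_cast (by omega : 1 < n))
    have hlogx : Real.log n ≤ Real.log x := Real.log_le_log hn0 hnx
    have hmf' : (1 / U) * Real.log x ≤ Real.log (Nat.minFac n) := by
      rw [← Real.log_rpow (by linarith)]
      exact Real.log_le_log (Real.rpow_pos_of_pos (by linarith) _) hmf
    have hu : 1 / U ≤ Real.log (Nat.minFac n) / Real.log n := by
      rw [le_div_iff₀ hlogn]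
      calc 1 / U * Real.log n ≤ 1 / U * Real.log x :=
            mul_le_mul_of_nonneg_left hlogx (by positivity)
        _ ≤ Real.log (Nat.minFac n) := hmf'
    rw [hg1 _ hu, mul_one]
  · exact mul_nonneg (A.a_nonneg n) (hg0 _)

/-- **Lower sandwich**: if `g ≤ 1` and `g(u) = 0` for `u ≤ a`, where `a (1 − θ') ≥ 1/U`
(`0 < θ' < 1`, `U > 0`), then for `x ≥ 1`,
`S_r(g; x) ≤ C_r(x, U) + S_r(g; x^{1−θ'})`: a term `n > x^{1−θ'}` with `g(u₁(n)) ≠ 0` has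
`log p_min(n) = u₁ log n > a (1 − θ') log x ≥ (log x)/U`, i.e. lies in the cell. [folklore] -/
theorem prSum_le_roughCell_add {A : SieveSequence} {r : ℕ} (hr : 1 ≤ r) {g : ℝ → ℝ}
    (hg1 : ∀ u, g u ≤ 1) {a : ℝ} (hga : ∀ u, u ≤ a → g u = 0)
    {U θ' : ℝ} (hU : 0 < U) (hθ'0 : 0 < θ') (hθ'1 : θ' < 1) (haU : 1 / U ≤ a * (1 - θ'))
    {x : ℝ} (hx : 1 ≤ x) :
    prSum A r g x ≤ roughCell A r U x + prSum A r g (x ^ (1 - θ')) := by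
  unfold roughCell prSum
  set P : ℕ → Prop := fun n : ℕ => Squarefree n ∧ ω n = r with hP
  set x' : ℝ := x ^ (1 - θ') with hx'
  have hx0 : 0 < x := by linarith
  have hx'1 : 1 ≤ x' := Real.one_le_rpow hx (by linarith)
  have hx'x : x' ≤ x := by
    rw [hx']
    exact Real.rpow_le_self_of_one_le hx (by linarith)
  have hfl : ⌊x'⌋₊ ≤ ⌊x⌋₊ := Nat.floor_mono hx'x
  -- split the `P_r`-filter at `⌊x'⌋`
  have hsplit := (Finset.sum_filter_add_sum_filter_not ((Finset.Icc 1 ⌊x⌋₊).filter P)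
    (fun n : ℕ => n ≤ ⌊x'⌋₊) (fun n => A.a n * g (Real.log (Nat.minFac n) / Real.log n))).symm
  rw [hsplit]
  -- first part = the `P_r`-sum at `x'`
  have hfirst : ((Finset.Icc 1 ⌊x⌋₊).filter P).filter (fun n : ℕ => n ≤ ⌊x'⌋₊) = (Finset.Icc 1 ⌊x'⌋₊).filter P := by
    ext n
    simp only [Finset.mem_filter, Finset.mem_Icc]
    constructor
    · rintro ⟨⟨⟨h1, _⟩, hp⟩, h3⟩; exact ⟨⟨h1, h3⟩, hp⟩
    · rintro ⟨⟨h1, h3⟩, hp⟩; exact ⟨⟨⟨h1, h3.trans hfl⟩, hp⟩, h3⟩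
  -- second part ≤ the cell
  have hsecond : (∑ n ∈ ((Finset.Icc 1 ⌊x⌋₊).filter P).filter (fun n : ℕ => ¬ n ≤ ⌊x'⌋₊),
      A.a n * g (Real.log (Nat.minFac n) / Real.log n)) ≤
      ∑ n ∈ ((Finset.Icc 1 ⌊x⌋₊).filter P).filter (fun n : ℕ => x ^ (1 / U) ≤ (Nat.minFac n : ℝ)),
        A.a n := by
    set S := (Finset.Icc 1 ⌊x⌋₊).filter P with hS
    set f : ℕ → ℝ := fun n => A.a n * g (Real.log (Nat.minFac n) / Real.log n) with hf
    have hsub : (S.filter (fun n : ℕ => ¬ n ≤ ⌊x'⌋₊)).filter (fun n => f n ≠ 0) ⊆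
        S.filter (fun n : ℕ => x ^ (1 / U) ≤ (Nat.minFac n : ℝ)) := by
      intro n hn
      simp only [Finset.mem_filter] at hn ⊢
      obtain ⟨⟨hnS, h1⟩, hne⟩ := hn
      refine ⟨hnS, ?_⟩
      have hgn : g (Real.log (Nat.minFac n) / Real.log n) ≠ 0 := fun h => hne (by
        simp only [hf, h, mul_zero])
      have hn2 := two_le_of_mem hr hnS
      have hn0 : (0 : ℝ) < n := by exact_mod_cast (by omega : 0 < n)
      have hlogn : 0 < Real.log n := Real.log_pos (by exact_mod_cast (by omega : 1 < n))
      have hu : a < Real.log (Nat.minFac n) / Real.log n := by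
        by_contra hle
        exact hgn (hga _ (not_lt.mp hle))
      have hnx' : x' < n := by
        have : ⌊x'⌋₊ < n := not_le.mp h1
        calc x' < (⌊x'⌋₊ : ℝ) + 1 := Nat.lt_floor_add_one x'
          _ ≤ n := by exact_mod_cast this
      have hlogx' : (1 - θ') * Real.log x < Real.log n := by
        rw [← Real.log_rpow hx0]
        exact Real.log_lt_log (by positivity) hnx'
      have ha0 : 0 < a := by
        have : 0 < 1 / U := by positivity
        have h1θ : 0 < 1 - θ' := by linarith
        nlinarith
      have hkey : (1 / U) * Real.log x ≤ Real.log (Nat.minFac n) := by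
        have e1 : a * Real.log n ≤ Real.log (Nat.minFac n) := by
          rw [lt_div_iff₀ hlogn] at hu; exact hu.le
        have e2 : a * ((1 - θ') * Real.log x) ≤ a * Real.log n :=
          mul_le_mul_of_nonneg_left hlogx'.le ha0.le
        have e3 : (1 / U) * Real.log x ≤ a * (1 - θ') * Real.log x :=
          mul_le_mul_of_nonneg_right haU (Real.log_nonneg hx)
        linarith
      have hmf0 : (0 : ℝ) < (Nat.minFac n : ℝ) := by exact_mod_cast (Nat.minFac_pos n)
      calc x ^ (1 / U) = Real.exp ((1 / U) * Real.log x) := by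
            rw [Real.rpow_def_of_pos hx0, mul_comm]
        _ ≤ Real.exp (Real.log (Nat.minFac n)) := Real.exp_le_exp.mpr hkey
        _ = (Nat.minFac n : ℝ) := Real.exp_log hmf0
    calc ∑ n ∈ S.filter (fun n : ℕ => ¬ n ≤ ⌊x'⌋₊), f n
        = ∑ n ∈ (S.filter (fun n : ℕ => ¬ n ≤ ⌊x'⌋₊)).filter (fun n => f n ≠ 0), f n :=
          (Finset.sum_filter_ne_zero _).symm
      _ ≤ ∑ n ∈ (S.filter (fun n : ℕ => ¬ n ≤ ⌊x'⌋₊)).filter (fun n => f n ≠ 0), A.a n :=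
          Finset.sum_le_sum fun n _ => by
            calc f n = A.a n * g _ := rfl
              _ ≤ A.a n * 1 := mul_le_mul_of_nonneg_left (hg1 _) (A.a_nonneg n)
              _ = A.a n := mul_one _
      _ ≤ ∑ n ∈ S.filter (fun n : ℕ => x ^ (1 / U) ≤ (Nat.minFac n : ℝ)), A.a n :=
          Finset.sum_le_sum_of_subset_of_nonneg hsub fun n _ _ => A.a_nonneg n
  rw [hfirst]
  linarith

/-- The prime sum `∑_{p ≤ x} a_p` is nonnegative. [folklore] -/
theorem primeSum_nonneg (A : SieveSequence) (x : ℝ) : 0 ≤ ∑ p ∈ Nat.primesLE ⌊x⌋₊, A.a p :=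
  Finset.sum_nonneg fun p _ => A.a_nonneg p

/-- The `P_r`-sum of a nonnegative test function is nonnegative. [folklore] -/
theorem prSum_nonneg (A : SieveSequence) (r : ℕ) {g : ℝ → ℝ} (hg0 : ∀ u, 0 ≤ g u) (x : ℝ) :
    0 ≤ prSum A r g x :=
  Finset.sum_nonneg fun n _ => mul_nonneg (A.a_nonneg n) (hg0 _)


/-! ### The law in terms of the main term `M_r(x)` -/

/-- The main term of Bombieri's law on `P_r`, before the weight:
`M_r(x) = (1 + (−1)^r) H A(x)/log x − (−1)^r ∑_{p ≤ x} a_p` (`= ∑_p a_p` for odd `r`,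
`= 2 H A(x)/log x − ∑_p a_p` for even `r`). [folklore] -/
def mainTerm (A : SieveSequence) (H : ℝ) (r : ℕ) (x : ℝ) : ℝ :=
  (1 + (-1 : ℝ) ^ r) * H * A.size x / Real.log x - (-1 : ℝ) ^ r * ∑ p ∈ Nat.primesLE ⌊x⌋₊, A.a p

/-- Bombieri's law on `P_r` (min form) as `S_r(g; x) = Φ_r(g) M_r(x) + o(A(x)/log x)`. [folklore] -/
theorem law_prSum (hPr : Bombieri1976_PrDistributionMin) {A : SieveSequence} {H : ℝ}
    (hA : A.IsBombieriSequence) (hH : A.HasDensityConstant H) {r : ℕ} (hr : 2 ≤ r) {g : ℝ → ℝ}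
    (hg : Continuous g) (hη : ∃ η : ℝ, 0 < η ∧ ∀ u : ℝ, u ≤ η → g u = 0) :
    (fun x : ℝ => prSum A r g x - bombieriMinWeight r g * mainTerm A H r x) =o[atTop]
      fun x : ℝ => A.size x / Real.log x := by
  refine (hPr A H hA hH r hr g hg hη).congr' (Eventually.of_forall fun x => ?_) EventuallyEq.rfl
  unfold prSum mainTerm
  ring

/-- `|M_r(x)| ≤ (2H + K) A(x)/log x` once `∑_{p ≤ x} a_p ≤ K A(x)/log x` (`x > 1`, `H ≥ 0`). [folklore] -/
theorem abs_mainTerm_le {A : SieveSequence} {H : ℝ} (hH0 : 0 ≤ H)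
    (hsize : ∀ x, A.size x = A.congrSum 1 x) (r : ℕ) {K x : ℝ} (hx1 : 1 < x)
    (hP : ∑ p ∈ Nat.primesLE ⌊x⌋₊, A.a p ≤ K * A.size x / Real.log x) :
    |mainTerm A H r x| ≤ (2 * H + K) * A.size x / Real.log x := by
  have hL : 0 < Real.log x := Real.log_pos hx1
  have hAx : 0 ≤ A.size x := SieveSequence.size_nonneg_of_size_eq hsize x
  have hP0 : 0 ≤ ∑ p ∈ Nat.primesLE ⌊x⌋₊, A.a p := primeSum_nonneg A x
  have hs1 : |(-1 : ℝ) ^ r| = 1 := by rw [abs_pow, abs_neg, abs_one, one_pow]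
  have hs2 : |1 + (-1 : ℝ) ^ r| ≤ 2 := by
    calc |1 + (-1 : ℝ) ^ r| ≤ |(1 : ℝ)| + |(-1 : ℝ) ^ r| := abs_add_le _ _
      _ = 2 := by rw [hs1, abs_one]; norm_num
  unfold mainTerm
  calc |(1 + (-1 : ℝ) ^ r) * H * A.size x / Real.log x - (-1 : ℝ) ^ r * ∑ p ∈ Nat.primesLE ⌊x⌋₊, A.a p|
      ≤ |(1 + (-1 : ℝ) ^ r) * H * A.size x / Real.log x| + |(-1 : ℝ) ^ r * ∑ p ∈ Nat.primesLE ⌊x⌋₊, A.a p| :=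
        abs_sub _ _
    _ = |1 + (-1 : ℝ) ^ r| * (H * A.size x / Real.log x) + ∑ p ∈ Nat.primesLE ⌊x⌋₊, A.a p := by
        rw [abs_mul, hs1, one_mul, abs_of_nonneg hP0]
        rw [show (1 + (-1 : ℝ) ^ r) * H * A.size x / Real.log x =
          (1 + (-1 : ℝ) ^ r) * (H * A.size x / Real.log x) by ring, abs_mul,
          abs_of_nonneg (by positivity : 0 ≤ H * A.size x / Real.log x)]
    _ ≤ 2 * (H * A.size x / Real.log x) + K * A.size x / Real.log x :=
        add_le_add (mul_le_mul_of_nonneg_right hs2 (by positivity)) hP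
    _ = (2 * H + K) * A.size x / Real.log x := by ring

/-! ### The rough cells of a Bombieri sequence -/

/-- **The rough `P_r`-cells of a Bombieri sequence (from Bombieri's law on `P_r`, min form).**
If `A` satisfies Bombieri's (A₁)–(A₅) with density constant `H`, then for every `r ≥ 2` and every
depth `U > 1`, the sharp-cutoff rough cell `C_r(x, U) = ∑_{n ≤ x, n ∈ P_r, p_min(n) ≥ x^{1/U}} a_n`
satisfies `C_r(x, U) = I_r(U) M_r(x) + o(A(x)/log x)`, i.e.
`C_r(x,U) = I_r(U) ∑_{p ≤ x} a_p + o(A/log x)` for odd `r` (the ghost `δ_x` of the primes carries over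
to every odd cell) and `C_r(x,U) = I_r(U) (2 H A(x)/log x − ∑_{p ≤ x} a_p) + o(A/log x)` for even `r`,
with Buchstab–Alladi's `I_r(U) = roughCellDensity r U`. Proof: sandwich the sharp cutoff between
continuous ramps of the smallest normalised prime factor (the terms `n ≤ x^{1−θ'}` being
`O(A(x^{1−θ'})/log x) = o(A(x)/log x)` by the law at `x^{1−θ'}` and (A₄)), and use the continuity
of `I_r` at `U`. [folklore] -/
theorem roughCell_isLittleO (hPr : Bombieri1976_PrDistributionMin) {A : SieveSequence} {H : ℝ}
    (hA : A.IsBombieriSequence) (hH : A.HasDensityConstant H) {r : ℕ} (hr : 2 ≤ r) {U : ℝ}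
    (hU : 1 < U) :
    (fun x : ℝ => roughCell A r U x - roughCellDensity r U * mainTerm A H r x) =o[atTop]
      fun x : ℝ => A.size x / Real.log x := by
  have hsize := hA.1
  have hH0 : 0 ≤ H := SieveSequence.HasDensityConstant.nonneg_of_bombieriA1 hH hA.2.1
  have hr1 : 1 ≤ r := by omega
  have hU0 : 0 < U := by linarith
  have hU1 : 1 ≤ U := hU.le
  obtain ⟨K, hK0, hK⟩ := BombieriP2.chebyshev_primeCount hA hH
  set I : ℝ := roughCellDensity r U with hI_def
  have hI0 : 0 ≤ I := roughCellDensity_nonneg r U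
  set K₃ : ℝ := 2 * H + K with hK₃
  have hK₃0 : 0 ≤ K₃ := by positivity
  rw [isLittleO_iff]
  intro c hc
  -- (1) continuity of `I_r` at `U`: the window `[Vm, Vp]`
  set ε₁ : ℝ := c / (4 * (K₃ + 1)) with hε₁
  have hε₁0 : 0 < ε₁ := by positivity
  have hε₁K : ε₁ * K₃ ≤ c / 4 := by
    rw [hε₁, div_mul_eq_mul_div, div_le_div_iff₀ (by positivity) (by norm_num)]
    nlinarith
  obtain ⟨ρ, hρ0, hρ⟩ := Metric.continuousAt_iff.mp (continuousAt_roughCellDensity r hU) ε₁ hε₁0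
  set ρ' : ℝ := min (ρ / 2) ((U - 1) / 2) with hρ'
  have hρ'0 : 0 < ρ' := lt_min (by linarith) (by linarith)
  have hρ'ρ : ρ' < ρ := lt_of_le_of_lt (min_le_left _ _) (by linarith)
  have hρ'U : ρ' ≤ (U - 1) / 2 := min_le_right _ _
  set Vp : ℝ := U + ρ' with hVp
  set Vm : ℝ := U - ρ' with hVm
  have hVm1 : 1 < Vm := by rw [hVm]; linarith
  have hVm0 : 0 < Vm := by linarith
  have hVmU : Vm < U := by rw [hVm]; linarith
  have hUVp : U < Vp := by rw [hVp]; linarith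
  have hVp0 : 0 < Vp := by linarith
  have hVp1 : 1 ≤ Vp := by linarith
  have hIVp : roughCellDensity r Vp - I < ε₁ := by
    have h := hρ (x := Vp) (by rw [Real.dist_eq, hVp, add_sub_cancel_left, abs_of_pos hρ'0]; exact hρ'ρ)
    rw [Real.dist_eq] at h
    exact lt_of_le_of_lt (le_abs_self _) h
  have hIVm : I - roughCellDensity r Vm < ε₁ := by
    have h := hρ (x := Vm) (by
      rw [Real.dist_eq, hVm, show U - ρ' - U = -ρ' by ring, abs_neg, abs_of_pos hρ'0]; exact hρ'ρ)
    rw [Real.dist_eq] at h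
    exact lt_of_le_of_lt (neg_le_abs _ |>.trans_eq' (by ring)) h
  -- (2) the two ramps
  have hθp : 0 < 1 / U - 1 / Vp := by
    rw [sub_pos]; exact one_div_lt_one_div_of_lt hU0 hUVp
  set gp : ℝ → ℝ := ramp (1 / Vp) (1 / U - 1 / Vp) with hgp
  have hgp0 : ∀ u, 0 ≤ gp u := fun u => ramp_nonneg _ _ _
  have hgp1 : ∀ u, gp u ≤ 1 := fun u => ramp_le_one _ _ _
  have hgp_zero : ∀ u, u ≤ 1 / Vp → gp u = 0 := fun u hu => ramp_eq_zero hθp hu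
  have hgp_one : ∀ u, 1 / U ≤ u → gp u = 1 := fun u hu => ramp_eq_one hθp (by linarith)
  set θ' : ℝ := (1 - Vm / U) / 2 with hθ'
  have hVmU' : Vm / U < 1 := (div_lt_one hU0).mpr hVmU
  have hVmU0 : 0 < Vm / U := div_pos hVm0 hU0
  have hθ'0 : 0 < θ' := by rw [hθ']; linarith
  have hθ'h : θ' < 1 / 2 := by rw [hθ']; linarith
  have hθ'1 : θ' < 1 := by linarith
  set a : ℝ := 1 / (U * (1 - θ')) with ha
  have h1θ : 0 < 1 - θ' := by linarith
  have ha0 : 0 < a := by rw [ha]; positivity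
  have haU' : a * (1 - θ') = 1 / U := by
    rw [ha, one_div, one_div, mul_inv, inv_mul_cancel_right₀ h1θ.ne']
  have haU : 1 / U ≤ a * (1 - θ') := haU'.symm.le
  have hUθ : Vm < U * (1 - θ') := by
    have e : U * (Vm / U) = Vm := by field_simp
    have : U * (1 - θ') = U - (U - Vm) / 2 := by
      rw [hθ']; linear_combination (1 / 2 : ℝ) * e
    rw [this]; linarith
  have ha_lt : a < 1 / Vm := by
    rw [ha]; exact one_div_lt_one_div_of_lt hVm0 hUθ
  have hθm : 0 < 1 / Vm - a := by linarith
  set gm : ℝ → ℝ := ramp a (1 / Vm - a) with hgm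
  have hgm0 : ∀ u, 0 ≤ gm u := fun u => ramp_nonneg _ _ _
  have hgm1 : ∀ u, gm u ≤ 1 := fun u => ramp_le_one _ _ _
  have hgm_zero : ∀ u, u ≤ a → gm u = 0 := fun u hu => ramp_eq_zero hθm hu
  have hgm_one : ∀ u, 1 / Vm ≤ u → gm u = 1 := fun u hu => ramp_eq_one hθm (by linarith)
  -- (3) the weights are within `ε₁` of `I`
  set Φp : ℝ := bombieriMinWeight r gp with hΦp
  set Φm : ℝ := bombieriMinWeight r gm with hΦm
  have hΦp_le : Φp ≤ roughCellDensity r Vp :=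
    weight_le_roughCellDensity hr (continuous_ramp _ _) hgp1 hVp1 hgp_zero
  have hΦp_ge : I ≤ Φp :=
    roughCellDensity_le_weight hr (continuous_ramp _ _) hgp0 (η := 1 / Vp) (by positivity) hgp_zero
      hU1 hgp_one
  have hUθ1 : 1 ≤ U * (1 - θ') := by linarith
  have hΦm_le : Φm ≤ I := by
    have h1 : Φm ≤ roughCellDensity r (U * (1 - θ')) :=
      weight_le_roughCellDensity hr (continuous_ramp _ _) hgm1 hUθ1 (by rw [← ha]; exact hgm_zero)
    have h2 : roughCellDensity r (U * (1 - θ')) ≤ I :=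
      monotone_roughCellDensity r (by nlinarith : U * (1 - θ') ≤ U)
    exact h1.trans h2
  have hΦm_ge : roughCellDensity r Vm ≤ Φm :=
    roughCellDensity_le_weight hr (continuous_ramp _ _) hgm0 ha0 hgm_zero hVm1.le hgm_one
  have hdevp : |Φp - I| ≤ ε₁ := by
    rw [abs_le]; constructor <;> linarith
  have hdevm : |Φm - I| ≤ ε₁ := by
    rw [abs_le]; constructor <;> linarith
  have hΦm0 : 0 ≤ Φm := (roughCellDensity_nonneg r Vm).trans hΦm_ge
  -- (4) the law instances and the other eventual inputs
  have hc₁ : 0 < c / 4 := by positivity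
  set c₂ : ℝ := c / (8 * (I * K₃ + 1)) with hc₂
  have hc₂0 : 0 < c₂ := by positivity
  have hc₂K : 2 * c₂ * (I * K₃ + 1) = c / 4 := by
    rw [hc₂]; field_simp; ring
  have hlp := law_prSum hPr hA hH hr (g := gp) (continuous_ramp _ _) ⟨1 / Vp, by positivity, hgp_zero⟩
  have hlm := law_prSum hPr hA hH hr (g := gm) (continuous_ramp _ _) ⟨a, ha0, hgm_zero⟩
  have htend : Tendsto (fun x : ℝ => x ^ (1 - θ')) atTop atTop := tendsto_rpow_atTop h1θ
  have hlm' := hlm.comp_tendsto htend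
  have hsz := BombieriP2.size_rpow_isLittleO hA hθ'0 hθ'1
  have hK' := htend.eventually hK
  have hXnn : ∀ y, 0 ≤ A.size y := SieveSequence.size_nonneg_of_size_eq hsize
  filter_upwards [hlp.def hc₁, hlm.def hc₁, hlm'.def one_pos, hsz.def hc₂0, hK, hK',
    eventually_gt_atTop (1 : ℝ), htend.eventually (eventually_gt_atTop (1 : ℝ))]
    with x hxp hxm hxm' hxsz hxK hxK' hx1 hx1'
  -- (5) the estimate at `x`
  simp only [Function.comp_def] at hxm'
  have hx0 : 0 < x := by linarith
  have hL : 0 < Real.log x := Real.log_pos hx1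
  set x' : ℝ := x ^ (1 - θ') with hx'
  have hL' : Real.log x' = (1 - θ') * Real.log x := by rw [hx', Real.log_rpow hx0]
  have hL'0 : 0 < Real.log x' := by rw [hL']; positivity
  have hAL : 0 ≤ A.size x / Real.log x := div_nonneg (hXnn x) hL.le
  have hAL' : 0 ≤ A.size x' / Real.log x' := div_nonneg (hXnn x') hL'0.le
  rw [Real.norm_eq_abs, Real.norm_eq_abs, abs_of_nonneg hAL] at hxp hxm
  rw [Real.norm_eq_abs, Real.norm_eq_abs, abs_of_nonneg hAL', one_mul] at hxm'
  rw [Real.norm_eq_abs, Real.norm_eq_abs, abs_of_nonneg (hXnn _), abs_of_nonneg (hXnn _)] at hxsz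
  rw [Real.norm_eq_abs, Real.norm_eq_abs, abs_of_nonneg hAL]
  -- main-term bounds
  have hM : |mainTerm A H r x| ≤ K₃ * A.size x / Real.log x := abs_mainTerm_le hH0 hsize r hx1 hxK
  have hM' : |mainTerm A H r x'| ≤ K₃ * A.size x' / Real.log x' := abs_mainTerm_le hH0 hsize r hx1' hxK'
  -- upper sandwich
  have hU2 : roughCell A r U x ≤ prSum A r gp x := roughCell_le_prSum hr1 hgp0 hU0 hgp_one hx1.le
  -- lower sandwich
  have hL2 : prSum A r gm x ≤ roughCell A r U x + prSum A r gm x' :=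
    prSum_le_roughCell_add hr1 hgm1 hgm_zero hU0 hθ'0 hθ'1 haU hx1.le
  -- the tail at `x'`
  have htail : prSum A r gm x' ≤ 2 * c₂ * (I * K₃ + 1) * (A.size x / Real.log x) := by
    have h1 : prSum A r gm x' ≤ Φm * mainTerm A H r x' + A.size x' / Real.log x' := by
      have := (abs_le.mp hxm').2; linarith
    have h2 : Φm * mainTerm A H r x' ≤ I * (K₃ * A.size x' / Real.log x') :=
      calc Φm * mainTerm A H r x' ≤ Φm * |mainTerm A H r x'| :=
            mul_le_mul_of_nonneg_left (le_abs_self _) hΦm0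
        _ ≤ I * (K₃ * A.size x' / Real.log x') := mul_le_mul hΦm_le hM' (abs_nonneg _) hI0
    have h3 : A.size x' / Real.log x' ≤ 2 * c₂ * (A.size x / Real.log x) := by
      rw [hL', div_le_iff₀ (by positivity)]
      calc A.size x' ≤ c₂ * A.size x := hxsz
        _ ≤ c₂ * A.size x * (2 * (1 - θ')) := by
            apply le_mul_of_one_le_right (mul_nonneg hc₂0.le (hXnn x)); linarith
        _ = 2 * c₂ * (A.size x / Real.log x) * ((1 - θ') * Real.log x) := by
            field_simp
    have h4 : 0 ≤ I * K₃ := mul_nonneg hI0 hK₃0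
    calc prSum A r gm x' ≤ I * (K₃ * A.size x' / Real.log x') + A.size x' / Real.log x' := by linarith
      _ = (I * K₃ + 1) * (A.size x' / Real.log x') := by ring
      _ ≤ (I * K₃ + 1) * (2 * c₂ * (A.size x / Real.log x)) :=
          mul_le_mul_of_nonneg_left h3 (by positivity)
      _ = 2 * c₂ * (I * K₃ + 1) * (A.size x / Real.log x) := by ring
  rw [hc₂K] at htail
  -- deviation products
  have hdp : (Φp - I) * mainTerm A H r x ≤ ε₁ * (K₃ * A.size x / Real.log x) :=
    calc (Φp - I) * mainTerm A H r x ≤ |(Φp - I) * mainTerm A H r x| := le_abs_self _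
      _ = |Φp - I| * |mainTerm A H r x| := abs_mul _ _
      _ ≤ ε₁ * (K₃ * A.size x / Real.log x) := mul_le_mul hdevp hM (abs_nonneg _) hε₁0.le
  have hdm : -(ε₁ * (K₃ * A.size x / Real.log x)) ≤ (Φm - I) * mainTerm A H r x :=
    calc -(ε₁ * (K₃ * A.size x / Real.log x)) ≤ -|(Φm - I) * mainTerm A H r x| := by
          rw [neg_le_neg_iff, abs_mul]
          exact mul_le_mul hdevm hM (abs_nonneg _) hε₁0.le
      _ ≤ (Φm - I) * mainTerm A H r x := neg_abs_le _
  have hεA : ε₁ * (K₃ * A.size x / Real.log x) ≤ c / 4 * (A.size x / Real.log x) := by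
    rw [show ε₁ * (K₃ * A.size x / Real.log x) = ε₁ * K₃ * (A.size x / Real.log x) by ring]
    exact mul_le_mul_of_nonneg_right hε₁K hAL
  -- assemble
  have hcAL : 0 ≤ c * (A.size x / Real.log x) := mul_nonneg hc.le hAL
  have ep : (Φp - I) * mainTerm A H r x = Φp * mainTerm A H r x - I * mainTerm A H r x := by ring
  have em : (Φm - I) * mainTerm A H r x = Φm * mainTerm A H r x - I * mainTerm A H r x := by ring
  have hup : roughCell A r U x - I * mainTerm A H r x ≤ c * (A.size x / Real.log x) := by
    have h1 : prSum A r gp x ≤ Φp * mainTerm A H r x + c / 4 * (A.size x / Real.log x) := by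
      have := (abs_le.mp hxp).2; linarith
    rw [ep] at hdp
    linarith
  have hlo : -(c * (A.size x / Real.log x)) ≤ roughCell A r U x - I * mainTerm A H r x := by
    have h1 : Φm * mainTerm A H r x - c / 4 * (A.size x / Real.log x) ≤ prSum A r gm x := by
      have := (abs_le.mp hxm).1; linarith
    rw [em] at hdm
    linarith
  exact abs_le.mpr ⟨hlo, hup⟩

/-- **The rough cells, division-free display** (the statement of `roughCell_isLittleO` with the
main term spelled out): `C_r(x,U) + (−1)^r I_r(U) ∑_{p ≤ x} a_p − (1 + (−1)^r) I_r(U) H A(x)/log x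
= o(A(x)/log x)`. [folklore] -/
theorem roughCell_isLittleO' (hPr : Bombieri1976_PrDistributionMin) {A : SieveSequence} {H : ℝ}
    (hA : A.IsBombieriSequence) (hH : A.HasDensityConstant H) {r : ℕ} (hr : 2 ≤ r) {U : ℝ}
    (hU : 1 < U) :
    (fun x : ℝ => roughCell A r U x +
        (-1 : ℝ) ^ r * roughCellDensity r U * (∑ p ∈ Nat.primesLE ⌊x⌋₊, A.a p) -
        (1 + (-1 : ℝ) ^ r) * roughCellDensity r U * H * A.size x / Real.log x)
      =o[atTop] fun x : ℝ => A.size x / Real.log x := by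
  refine (roughCell_isLittleO hPr hA hH hr hU).congr' (Eventually.of_forall fun x => ?_)
    EventuallyEq.rfl
  unfold mainTerm
  ring

end BombieriRoughCells

end Literature.NumberTheory.Sieve

end
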